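import Summits.Ventures.CertifiedQuantumChemistry.Rows.V2RDMDualKernelBlocks
import Summits.Ventures.CertifiedQuantumChemistry.Rows.V2RDMDualKernelPack
import HarnessLib


/-!
# Ventures/CertifiedQuantumChemistry — Rows/V2RDMDualKernel.lean: a KERNEL-CHECKED dual certificate for the variational 2-RDM (DQG) lower bound

HONEST FRAMING (verbatim): certified bounds for a stated model Hamiltonian in a stated basis; not a
claim about the real molecule beyond that model.

WHAT THIS FILE IS. The cell's molecular LOWER rows of record are v2RDM (DQG / DQGT1 / …) semidefinite
relaxation bounds whose rational dual certificates (`certsdp` `cert/0`: Gram factors `G_b = L_b L_bᵀ / 4^K`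
per PSD block, row multipliers `λ`, a residual absorbed by a-priori variable bounds) are verified by two
EXTERNAL exact-arithmetic scripts; in the tree they are claim nodes. This file makes such a certificate
checkable by the LEAN KERNEL: a computable checker `Cert.check F a b c : Bool` over the tree's literal
rational model `F : Model k`, and the soundness theorem

  `lowerRow_of_check : Cert.check F a b c = true → F.IsSymmetric → a ≤ k → b ≤ k → a + b ≠ 0 →
     a + b + 2 ≤ 2k → LowerRow F a b c.lo`,

proved from the tree's relaxation theorem `le_sectorGroundEnergy_of_forall_isDQGFeasibleSector`
(Literature, Mazziotti 2007 / Nakata et al. 2008): the kernel DERIVES the objective (from `rdmEnergy` at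
`F`'s tables), the equality rows (the spin traces and the spin-resolved contraction rows, theorems of
`Rows/GMatrixRelaxationKernel.lean`) and the block-entry linear forms (from `γ`, `1 − γᵀ`, `Γ`, `qMap`,
`gMap`) as linear forms in the raw moments `Re γ_xy`, `Re Γ_{(x₁x₂),(y₁y₂)}`; multiplies them by the
certificate's multipliers / Gram entries; canonicalises every moment by Hermiticity and antisymmetry;
sorts and groups equal moments; and bounds the grouped residual by the a-priori bounds `|Re γ_xy| ≤ 1`,
`|Re Γ_PQ| ≤ 1` valid on the DQG-feasible set (Pauli bound `γ ≤ 1`, `G`-condition diagonal). Weak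
duality is the Gram pairing `Σ_ij (L Lᵀ)_ij Re B_ij = Σ_t Re ⟨ℓ_t, B ℓ_t⟩ ≥ 0` for the feasible point's
PSD blocks `B`. Nothing in the certificate is trusted: a wrong multiplier, factor, member list or block
kind can only make the proved number smaller, never unsound; the claimed `lo` is compared last.

TWO ENTRY POINTS. (1) `lowerRow_of_check` — one `Cert.check F a b c = true`, discharged by ONE
`decide +kernel` (small instances: `Certificates/HubbardRingL4U1DQGKernelLower.lean`, the L = 4 Hubbard
ring at U/t = 1, sector (2,2), DQG). (2) `lowerRow_of_staged` — for instances whose single check exceeds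
one kernel computation's memory: the objective is split into chunks `objChunk F p` (first orbital index)
whose grouped canonical residuals are asserted equal to literals chunk by chunk (`IsObjPoly`,
`isObjPoly_of_chunks`; e.g. `Certificates/N2Sto6gReMomentObjective.lean`), the certificate `SCert` into its
λ-row chunk and BATCHES of PSD blocks (`SCert.chunkRows`, one `decide +kernel` per chunk against a literal
`R i`), and `SCert.finalCheck` merges the literals and compares `lo ≤ E_core + Σ constants − ℓ¹(merged
residual)` (e.g. `Certificates/N2Sto6gRe77DQGKernelLower.lean`: N₂ STO-6G at R_e, sector (7,7), DQG,
18 864 Gram rows in 6 batches). In both paths every literal is UNTRUSTED certificate data decoded by the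
kernel (`Pack.*`: base-`B` digit strings → integer rows / rationals / descriptors); a wrong literal makes
its own equation fail and nothing else.

PROVENANCE. Written by the rdm-A seat (pub-qchem, gen 61) as the KERNEL-SDP lane of the cell's plan:
the certificates re-checked here are the cell's files of record (`certs/S0H/…` Hubbard, `certs/N2-sto6g-re/
n2re_na7_nb7_DQG.{problem0,cert0}.json.gz` N₂), converted OFFLINE (exact arithmetic) from the `certsdp`
`cert/0` format into this file's raw-moment coordinates; the conversion is not trusted either — only
`LowerRow F a b lo` with the tree's literal model `F` is proved.

MODULE LAYOUT (gate lint: ≤ 400 lines per file). `Rows/V2RDMDualKernelTerms.lean` (descriptors, forms, values, canonicalisation) →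
`Rows/V2RDMDualKernelResidual.lean` (drop / sort / group / ℓ¹, a-priori bounds, objective, equality rows) → `Rows/V2RDMDualKernelBlocks.lean`
(PSD block entries, Gram pairing, block form); `Rows/V2RDMDualKernelPack.lean` (packed literals, regrouped tables); THIS FILE: the certificate,
the checker `Cert.check`, the staged checker (`objChunk` / `IsObjPoly` / `SCert.chunkRows` / `SCert.finalCheck`) and the two entry points.
-/

namespace Summit.Ventures.CertifiedQuantumChemistry

open Matrix Finset
open scoped ComplexOrder
open Literature.MathematicalPhysics.QuantumLattice Literature.MathematicalPhysics.QuantumChemistry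

namespace V2RDMDual

section Semantics

variable {k : ℕ} [NeZero k] {γ : M1 k} {Γ : M2 k}

/-! ## The certificate, the total form, the checker -/

/-- A dual certificate: Gram scale exponent `K` (weights `/ 4^K`), row multipliers aligned with
`rowList k a b`, PSD blocks (kind, member list, integer factor rows), and the claimed bound. -/
structure Cert where
  /-- Gram factors are read as `L Lᵀ / 4^K`. -/
  K : ℕ
  /-- multipliers of the rows of `rowList k a b`, in order (missing ones read as absent). -/
  lam : List ℚ
  /-- PSD blocks: kind, members (spin-orbital numbers; one-index kinds use `.1`), factor rows. -/
  blocks : List (BKind × List (ℕ × ℕ) × List (List ℤ))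
  /-- the claimed lower bound. -/
  lo : ℚ

/-- Rows scaled by `−λ`. -/
def lamRows (lam : List ℚ) (rows : List Row) : List Row :=
  List.zipWith (fun (l : ℚ) (r : Row) => (-l * r.1, r.2.map (scale (-l)))) lam rows

/-- Multiplier-weighted equality rows have value `0` on the feasible set. -/
theorem lamRows_val {lam : List ℚ} {rows : List Row}
    (h : ∀ r ∈ rows, rowVal (k := k) (γ := γ) (Γ := Γ) r = 0) :
    rowsVal (k := k) (γ := γ) (Γ := Γ) (lamRows lam rows) = 0 := by
  induction rows generalizing lam with
  | nil => cases lam <;> simp [lamRows]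
  | cons r rs ih =>
    cases lam with
    | nil => simp [lamRows]
    | cons l ls =>
      have hr := h r (by simp)
      have ih' := ih (lam := ls) fun r' hr' => h r' (by simp [hr'])
      simp only [lamRows, List.zipWith_cons_cons, rowsVal_cons] at ih' ⊢
      rw [ih', add_zero, rowVal, termsVal_map_scale]
      rw [rowVal] at hr
      push_cast
      have : (-(l : ℝ)) * ((r.1 : ℝ) + termsVal k γ Γ r.2) = 0 := by rw [hr, mul_zero]
      linarith

/-- Collect a list of rows into one (sum of constants, concatenation of terms). -/
def collect (rs : List Row) : Row := ((rs.map Prod.fst).sum, rs.flatMap Prod.snd)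

/-- Collecting a row list into one row preserves the value. -/
theorem collect_val (rs : List Row) :
    rowVal (k := k) (γ := γ) (Γ := Γ) (collect rs) = rowsVal (k := k) (γ := γ) (Γ := Γ) rs := by
  induction rs with
  | nil => simp [collect, rowVal]
  | cons r rs ih =>
    simp only [collect, rowVal, List.map_cons, List.sum_cons, List.flatMap_cons, termsVal_append, rowsVal_cons] at ih ⊢
    push_cast at ih ⊢
    linarith

/-- The total form `E − Σ λ·row − Σ_b ⟨G_b, B_b⟩ / 4^K` as (constant, terms). -/
def certForm (F : Model k) (a b : ℕ) (c : Cert) : Row :=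
  let s : ℚ := 1 / 4 ^ c.K
  let rows := collect (lamRows c.lam (rowList k a b))
  let blks := collect (c.blocks.flatMap fun blk => blockPieces blk.1 blk.2.1 blk.2.2 s)
  (F.ecore + rows.1 + blks.1, objTerms F ++ rows.2 ++ blks.2)

/-- The grouped canonical residual of a form. -/
def residual (n : ℕ) (ts : List Term) : List Term := group (sortTerms n (dropZero (ts.map canon)))

/-- **The checker**: member validity, and `lo ≤ constant − ℓ¹(grouped residual)`. -/
def Cert.check (F : Model k) (a b : ℕ) (c : Cert) : Bool :=
  (c.blocks.all fun blk => blockValid (2 * k) blk.2.1) &&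
    (let cf := certForm F a b c
     decide (c.lo ≤ cf.1 - l1 (residual (2 * k) cf.2)))

/-- Weak duality: the total certificate form is bounded above by `Re E(γ, Γ) − ecore` on the sector-feasible set. -/
theorem certForm_val_le (F : Model k) {a b : ℕ} (c : Cert) (h : IsDQGFeasibleSector a b γ Γ) (hab : a + b ≠ 0)
    (hr : a + b + 2 ≤ Fintype.card (Orb (Fin k))) (hv : (c.blocks.all fun blk => blockValid (2 * k) blk.2.1) = true) :
    rowVal (k := k) (γ := γ) (Γ := Γ) (certForm F a b c) ≤
      (rdmEnergy (fun p q => (F.h p q : ℂ)) (fun p q r s => (F.eri p q r s : ℂ)) (F.ecore : ℂ) γ Γ).re := by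
  rw [re_rdmEnergy_eq]
  have hrows := lamRows_val (lam := c.lam) (rowList_val (k := k) h hab)
  have hblk : rowsVal (k := k) (γ := γ) (Γ := Γ)
      (c.blocks.flatMap fun blk => blockPieces blk.1 blk.2.1 blk.2.2 (1 / 4 ^ c.K)) ≤ 0 := by
    rw [rowsVal_flatMap]
    apply list_sum_nonpos
    intro x hx
    rw [List.mem_map] at hx
    obtain ⟨blk, hblk, rfl⟩ := hx
    have hvb : blockValid (2 * k) blk.2.1 = true := by
      rw [List.all_eq_true] at hv; exact hv blk hblk
    exact blockPieces_val_le h.dqg hr blk.1 blk.2.1 blk.2.2 (by positivity) hvb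
  have e : rowVal (k := k) (γ := γ) (Γ := Γ) (certForm F a b c) = (F.ecore : ℝ) + termsVal k γ Γ (objTerms F) +
      rowVal (k := k) (γ := γ) (Γ := Γ) (collect (lamRows c.lam (rowList k a b))) +
      rowVal (k := k) (γ := γ) (Γ := Γ) (collect (c.blocks.flatMap fun blk => blockPieces blk.1 blk.2.1 blk.2.2 (1 / 4 ^ c.K))) := by
    simp only [certForm, rowVal, termsVal_append]; push_cast; ring
  rw [e, collect_val, collect_val, hrows]
  linarith

/-- The canonicalised, grouped residual bounds a form from below by minus its ℓ¹ norm. -/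
theorem residual_bound {N : ℕ} (h : IsDQGFeasible N γ Γ) (hr : N + 2 ≤ Fintype.card (Orb (Fin k))) (n : ℕ) (ts : List Term) :
    -(l1 (residual n ts) : ℝ) ≤ termsVal k γ Γ ts := by
  have h1 := neg_l1_le (abs_val_le_one (k := k) h hr) (residual n ts)
  rw [residual, termsVal_group, termsVal_perm (sortTerms_perm _ _), termsVal_dropZero, termsVal_map_canon h] at h1
  exact h1

/-! ## Staged checking (large instances)

One kernel declaration per CHUNK: the objective is split by the first orbital index (`objChunk`), the
certificate into its λ-rows and BATCHES of PSD blocks (`SCert.chunkRows`). Each chunk's constant and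
grouped canonical residual is asserted equal to a literal (one `decide +kernel`, hence one auxiliary
lemma and one bounded kernel computation, per chunk), and a final small declaration merges the literals
(`SCert.finalCheck`). Soundness is `lowerRow_of_staged`; the literals are untrusted like all certificate
data (a wrong literal makes its chunk equation fail, nothing else). -/

/-- Objective chunk `p`: the `h`-terms of row `p` and the `eri`-terms with first index `p`. -/
def objChunk (F : Model k) (p : Fin k) : List Term :=
  ((List.finRange k).flatMap fun q => emit (F.h p q) [.one p q, .one (p + k) (q + k)]) ++
  ((List.finRange k).flatMap fun q => (List.finRange k).flatMap fun r => (List.finRange k).flatMap fun s =>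
      emit (F.eri p q r s / 2)
        [.two p r q s, .two p (r + k) q (s + k), .two (p + k) r (q + k) s, .two (p + k) (r + k) (q + k) (s + k)])

/-- The objective chunks (one per first orbital index) together re-assemble the objective form. -/
theorem termsVal_objChunks (F : Model k) :
    termsVal k γ Γ ((List.finRange k).flatMap (objChunk F)) = termsVal k γ Γ (objTerms F) := by
  simp only [objChunk, objTerms, termsVal_append, termsVal_flatMap, list_sum_finRange, Finset.sum_add_distrib]

/-- `P` has the value of the objective terms of `F` at every DQG-feasible pair `(γ, Γ)`. -/
def IsObjPoly (F : Model k) (P : List Term) : Prop :=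
  ∀ (N : ℕ) (γ' : M1 k) (Γ' : M2 k), IsDQGFeasible N γ' Γ' → termsVal k γ' Γ' P = termsVal k γ' Γ' (objTerms F)

/-- Taking the residual (canonicalise, sort, group) preserves the value on the feasible set. -/
theorem termsVal_residual {N : ℕ} (h : IsDQGFeasible N γ Γ) (n : ℕ) (ts : List Term) :
    termsVal k γ Γ (residual n ts) = termsVal k γ Γ ts := by
  rw [residual, termsVal_group, termsVal_perm (sortTerms_perm _ _), termsVal_dropZero, termsVal_map_canon h]

/-- Value of a flattened list of forms is the sum of the values. -/
theorem termsVal_flatten (ls : List (List Term)) :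
    termsVal k γ Γ ls.flatten = (ls.map (termsVal k γ Γ)).sum := by
  induction ls with
  | nil => simp
  | cons l ls ih => simp [ih]

/-- Merge already-grouped partial residual lists and group again. -/
def mergeGroup (n : ℕ) (ls : List (List Term)) : List Term := group (sortTerms n ls.flatten)

/-- `mergeGroup` of a list of forms has the value of their sum. -/
theorem termsVal_mergeGroup (n : ℕ) (ls : List (List Term)) :
    termsVal k γ Γ (mergeGroup n ls) = (ls.map (termsVal k γ Γ)).sum := by
  rw [mergeGroup, termsVal_group, termsVal_perm (sortTerms_perm _ _), termsVal_flatten]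

/-- **Objective by chunks**: per-chunk grouped residuals `R p` (each its own kernel fact) merge into an
objective polynomial. -/
theorem isObjPoly_of_chunks (F : Model k) (R : Fin k → List Term)
    (hR : ∀ p : Fin k, residual (2 * k) (objChunk F p) = R p) :
    IsObjPoly F (mergeGroup (2 * k) (List.ofFn R)) := by
  intro N γ' Γ' h
  have e1 : termsVal k γ' Γ' (mergeGroup (2 * k) (List.ofFn R)) = ∑ p : Fin k, termsVal k γ' Γ' (R p) := by
    rw [termsVal_mergeGroup, List.map_ofFn, List.sum_ofFn]; rfl
  have e2 : ∀ p, termsVal k γ' Γ' (R p) = termsVal k γ' Γ' (objChunk F p) := fun p => by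
    rw [← hR p, termsVal_residual h]
  rw [e1, Finset.sum_congr rfl (fun p _ => e2 p), ← termsVal_objChunks, termsVal_flatMap, list_sum_finRange]

/-- A PSD block of a certificate: kind, members, integer factor rows. -/
abbrev Block := BKind × List (ℕ × ℕ) × List (List ℤ)

/-- A STAGED dual certificate: as `Cert`, with the PSD blocks in batches (one kernel chunk per batch). -/
structure SCert where
  /-- Gram factors are read as `L Lᵀ / 4^K`. -/
  K : ℕ
  /-- multipliers of the rows of `rowList k a b`, in order. -/
  lam : List ℚ
  /-- PSD blocks, in batches. -/
  batches : List (List Block)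
  /-- the claimed lower bound. -/
  lo : ℚ

variable (k) in
/-- The certificate's chunks as rows: the λ-scaled equality rows, then one row per batch of PSD blocks. -/
def SCert.chunkRows (a b : ℕ) (c : SCert) : List Row :=
  collect (lamRows c.lam (rowList k a b)) ::
    c.batches.map fun bt => collect (bt.flatMap fun blk => blockPieces blk.1 blk.2.1 blk.2.2 (1 / 4 ^ c.K))

/-- Output of a chunk: its constant and its grouped canonical residual. -/
def chunkOut (n : ℕ) (r : Row) : ℚ × List Term := (r.1, residual n r.2)

variable (k) in
/-- Member validity of every block. -/
def SCert.valid (c : SCert) : Bool := c.batches.all fun bt => bt.all fun blk => blockValid (2 * k) blk.2.1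

/-- **Final (small) check**: validity, chunk count, and `lo ≤ E_core + Σ chunk constants − ℓ¹(merge of the
objective polynomial `P` and the chunk residuals `R`)`. -/
def SCert.finalCheck (F : Model k) (c : SCert) (P : List Term) (R : List (ℚ × List Term)) : Bool :=
  SCert.valid k c && decide (R.length = c.batches.length + 1) &&
    decide (c.lo ≤ F.ecore + (R.map Prod.fst).sum - l1 (mergeGroup (2 * k) (P :: R.map Prod.snd)))

/-- Weak duality for the staged certificate: its multiplier and block rows have nonpositive total value on the sector-feasible set. -/
theorem chunkRows_val_le {a b : ℕ} (c : SCert) (h : IsDQGFeasibleSector a b γ Γ) (hab : a + b ≠ 0)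
    (hr : a + b + 2 ≤ Fintype.card (Orb (Fin k))) (hv : SCert.valid k c = true) :
    rowsVal (k := k) (γ := γ) (Γ := Γ) (SCert.chunkRows k a b c) ≤ 0 := by
  rw [SCert.chunkRows, rowsVal_cons, collect_val, lamRows_val (lam := c.lam) (rowList_val (k := k) h hab), zero_add,
    rowsVal, List.map_map]
  apply list_sum_nonpos
  intro x hx
  rw [List.mem_map] at hx
  obtain ⟨bt, hbt, rfl⟩ := hx
  rw [Function.comp_apply, collect_val, rowsVal_flatMap]
  apply list_sum_nonpos
  intro y hy
  rw [List.mem_map] at hy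
  obtain ⟨blk, hblk, rfl⟩ := hy
  have hvb : blockValid (2 * k) blk.2.1 = true := by
    simp only [SCert.valid, List.all_eq_true] at hv; exact hv bt hbt blk hblk
  exact blockPieces_val_le h.dqg hr blk.1 blk.2.1 blk.2.2 (by positivity) hvb

/-- A mapped list sum as a `Fin`-indexed sum through `getD`. -/
theorem sum_map_eq_sum_fin {α β : Type*} [AddCommMonoid β] (f : α → β) (d : α) :
    ∀ (l : List α), (l.map f).sum = ∑ i : Fin l.length, f (l.getD i d)
  | [] => by simp
  | a :: l => by
    rw [List.map_cons, List.sum_cons, List.length_cons, Fin.sum_univ_succ, sum_map_eq_sum_fin f d l]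
    simp

end Semantics


/-- `|Orb (Fin k)| = 2k`. -/
theorem card_orb_fin (k : ℕ) : Fintype.card (Orb (Fin k)) = 2 * k := by
  simp [Orb, Fintype.card_lex, Fintype.card_prod, Fintype.card_fin, mul_comm]

/-- **KERNEL ENTRY POINT.** A certificate that passes the checker proves the LOWER row at its claimed bound. -/
theorem lowerRow_of_check {k : ℕ} [NeZero k] (F : Model k) (hF : F.IsSymmetric) (a b : ℕ) (ha : a ≤ k) (hb : b ≤ k)
    (hab : a + b ≠ 0) (hcard : a + b + 2 ≤ 2 * k) (c : Cert) (hc : Cert.check F a b c = true) :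
    LowerRow F a b c.lo := by
  refine ⟨ha, hb, ?_⟩
  simp only [Cert.check, Bool.and_eq_true, decide_eq_true_eq] at hc
  obtain ⟨hv, hlo⟩ := hc
  show ((c.lo : ℚ) : ℝ) ≤ sectorGroundEnergy F.hamiltonian a b
  refine le_sectorGroundEnergy_of_forall_isDQGFeasibleSector (Model.hamiltonian_isHermitian hF)
    (by simpa using ha) (by simpa using hb) fun γ Γ hfeas => ?_
  have hr : a + b + 2 ≤ Fintype.card (Orb (Fin k)) := by rw [card_orb_fin]; exact hcard
  have h1 := certForm_val_le (k := k) (γ := γ) (Γ := Γ) F c hfeas hab hr hv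
  have h2 := residual_bound (k := k) (γ := γ) (Γ := Γ) hfeas.dqg hr (2 * k) (certForm F a b c).2
  rw [rowVal] at h1
  have h3 : ((c.lo : ℚ) : ℝ) ≤ ((certForm F a b c).1 : ℝ) - (l1 (residual (2 * k) (certForm F a b c).2) : ℝ) := by
    exact_mod_cast hlo
  linarith

/-- **STAGED KERNEL ENTRY POINT** (large instances). -/
theorem lowerRow_of_staged {k : ℕ} [NeZero k] (F : Model k) (hF : F.IsSymmetric) (a b : ℕ) (ha : a ≤ k) (hb : b ≤ k)
    (hab : a + b ≠ 0) (hcard : a + b + 2 ≤ 2 * k) (c : SCert) (P : List Term) (hP : IsObjPoly F P)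
    (R : List (ℚ × List Term)) (m : ℕ) (hm : c.batches.length + 1 = m)
    (hR : ∀ i : Fin m, chunkOut (2 * k) ((SCert.chunkRows k a b c).getD i (0, [])) = R.getD i (0, []))
    (hfin : SCert.finalCheck F c P R = true) : LowerRow F a b c.lo := by
  refine ⟨ha, hb, ?_⟩
  simp only [SCert.finalCheck, Bool.and_eq_true, decide_eq_true_eq] at hfin
  obtain ⟨⟨hv, hlen⟩, hlo⟩ := hfin
  show ((c.lo : ℚ) : ℝ) ≤ sectorGroundEnergy F.hamiltonian a b
  refine le_sectorGroundEnergy_of_forall_isDQGFeasibleSector (Model.hamiltonian_isHermitian hF)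
    (by simpa using ha) (by simpa using hb) fun γ Γ hfeas => ?_
  have hr : a + b + 2 ≤ Fintype.card (Orb (Fin k)) := by rw [card_orb_fin]; exact hcard
  rw [re_rdmEnergy_eq]
  have hchunks := chunkRows_val_le (k := k) (γ := γ) (Γ := Γ) c hfeas hab hr hv
  have hlenC : (SCert.chunkRows k a b c).length = m := by simp [SCert.chunkRows, hm]
  have hlenR : R.length = m := by rw [hlen, hm]
  -- the chunk values through the literals
  have e1 : rowsVal (k := k) (γ := γ) (Γ := Γ) (SCert.chunkRows k a b c) =
      ((R.map Prod.fst).sum : ℚ) + ((R.map Prod.snd).map (termsVal k γ Γ)).sum := by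
    rw [rowsVal, sum_map_eq_sum_fin _ (0, []), List.map_map, sum_map_eq_sum_fin _ (0, []) R,
      sum_map_eq_sum_fin _ (0, []) R, hlenC, hlenR]
    push_cast
    rw [← Finset.sum_add_distrib]
    refine Finset.sum_congr rfl fun i _ => ?_
    have hi := hR i
    simp only [chunkOut, Prod.ext_iff] at hi
    rw [rowVal, hi.1, Function.comp_apply, ← hi.2, termsVal_residual hfeas.dqg]
  have e2 : termsVal k γ Γ (mergeGroup (2 * k) (P :: R.map Prod.snd)) =
      termsVal k γ Γ (objTerms F) + ((R.map Prod.snd).map (termsVal k γ Γ)).sum := by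
    rw [termsVal_mergeGroup, List.map_cons, List.sum_cons, hP _ γ Γ hfeas.dqg]
  have e3 := neg_l1_le (abs_val_le_one (k := k) hfeas.dqg hr) (mergeGroup (2 * k) (P :: R.map Prod.snd))
  have h3 : ((c.lo : ℚ) : ℝ) ≤ (F.ecore : ℝ) + ((R.map Prod.fst).sum : ℚ) -
      (l1 (mergeGroup (2 * k) (P :: R.map Prod.snd)) : ℝ) := by exact_mod_cast hlo
  linarith

end V2RDMDual

end Summit.Ventures.CertifiedQuantumChemistry
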